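import Summits.CriticalPhenomena.PercolationContinuityZ3.Theorems.PercNearOneGluingNoHeavyLowerTailIncStarBridgeChord
import Summits.CriticalPhenomena.PercolationContinuityZ3.Theorems.PercNearOneGluingNoHeavyLowerTailIncStarApexForestSchema
import HarnessLib

/-!
# THEOREM C: the increasing star holds on every apex-forest (unconditional), and on every graph whose environment cycles are sure

Support file for the Sahi programme (`--supports stmt-CriticalPhenomena-4575`, prover prim-sahi-p2 gen 19).  No definitions, no named
facts, no sorries; standard axioms.  Memo `run/shared/lean/prim/prim-sahi/prim-sahi-p2/gen18/THEOREM-B-C.md`, `PROOF-E3.md` §28m/§29.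

Combines THEOREM B (`IncStar.incStar_bridge_chord`, `…IncStarBridgeChord`: Sahi's cubic of the increasing star lies above its chords along
every environment bridge separating one target from the other two — on EVERY finite graph) with the induction of `…IncStarApexForestSchema`
(blob move + chord move + star-of-blocks base).

* **`incStar_nonneg_of_apexForest` (THEOREM C).**  For product Bernoulli bond percolation `prodBernoulli w` on the pairs of `Fin n`, a root `s`
  and ANY targets `a b c`: if the environment — the graph `fromEdgeSet {z | s ∉ z ∧ w z ≠ 0}` of non-root pairs of positive weight — is ACYCLIC,
  then `0 ≤ E₃({s↔a},{s↔b},{s↔c})`.  New infinite family for Kahn's product-measure `C₃` / Sahi positivity of the increasing star: all fans,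
  root + any tree with any root attachments, θ-graphs rooted at a pole, acyclic bypass bundles; with the blob reduction (`…SahiBlobReduction`),
  every graph that becomes an apex-forest after replacing target-free two-terminal subnetworks by single pairs.
* **`incStar_nonneg_of_sureEnvCycles` (THEOREM C♯, same induction, Theorem B being valid on all graphs).**  It suffices that every environment
  pair of weight `< 1` is a BRIDGE of the environment, i.e. that every cycle of `G` avoiding the root consists of weight-`1` pairs (in the
  fixed-vertex formalism this replaces 'contract the sure pairs first').  The class is closed under the three moves (pinning a fractional bridge
  to `0` or `1`, blob reduction), which is all the induction needs (`apexForest_blob_eq` re-exports the blob move with the extra information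
  that the reduced weight agrees with the old one on its environment).
-/

noncomputable section

namespace Summit.CriticalPhenomena.PercolationContinuityZ3.Theorems

namespace IncStar

open MeasureTheory Set Literature.Probability.Percolation Literature.Probability.LatticeModels EdgeInduction
open scoped Classical

variable {n : ℕ}

/-- **THEOREM C (the increasing star on every apex-forest).**  If the non-root pairs of positive weight form an acyclic graph, then
`E₃({s↔a},{s↔b},{s↔c}) ≥ 0` under `prodBernoulli w`, for every root `s` and all targets `a, b, c`. [this work] -/
theorem incStar_nonneg_of_apexForest (w : Sym2 (Fin n) → unitInterval) (s a b c : Fin n)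
    (hforest : (SimpleGraph.fromEdgeSet {z : Sym2 (Fin n) | s ∉ z ∧ w z ≠ 0}).IsAcyclic) :
    0 ≤ sahiE3 (prodBernoulli w) (openConn s a) (openConn s b) (openConn s c) :=
  incStar_nonneg_of_apexForest_of_bridgeChord
    (fun w L _ _ _ _ _ _ hsL huL hvL haL hbL hcL hcross => incStar_bridge_chord w L hsL huL hvL haL hbL hcL hcross) w s a b c hforest

/-! ### THEOREM C♯: environment cycles made of sure pairs -/

/-- A bridge of a graph remains a bridge of every spanning subgraph containing it (or not). [folklore] -/
theorem isBridge_anti {G G' : SimpleGraph (Fin n)} (h : G' ≤ G) {u v : Fin n} (hb : G.IsBridge s(u, v)) :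
    G'.IsBridge s(u, v) := by
  rw [SimpleGraph.isBridge_iff] at hb ⊢
  exact fun hr => hb (hr.mono (SimpleGraph.deleteEdges_mono h))

/-- **Blob move, with the environment values** (variant of `apexForest_blob`): the reduced weight moreover AGREES with `w` on every environment
pair of positive reduced weight. [this work] -/
theorem apexForest_blob_eq (w : Sym2 (Fin n) → unitInterval) {s t t' a b c : Fin n} (hts : t ≠ s) (ht's : t' ≠ s)
    (hfrac : s(t, t') ∈ (fracEdges w).filter fun z => ¬ z.IsDiag ∧ s ∉ z)
    (hbridge : ¬ ((SimpleGraph.fromEdgeSet {z : Sym2 (Fin n) | s ∉ z ∧ w z ≠ 0}).deleteEdges {s(t, t')}).Reachable t t')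
    (ha : ¬ ((SimpleGraph.fromEdgeSet {z : Sym2 (Fin n) | s ∉ z ∧ w z ≠ 0}).deleteEdges {s(t, t')}).Reachable t a)
    (hb : ¬ ((SimpleGraph.fromEdgeSet {z : Sym2 (Fin n) | s ∉ z ∧ w z ≠ 0}).deleteEdges {s(t, t')}).Reachable t b)
    (hc : ¬ ((SimpleGraph.fromEdgeSet {z : Sym2 (Fin n) | s ∉ z ∧ w z ≠ 0}).deleteEdges {s(t, t')}).Reachable t c) :
    ∃ w' : Sym2 (Fin n) → unitInterval,
      sahiE3 (prodBernoulli w) (openConn s a) (openConn s b) (openConn s c) =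
          sahiE3 (prodBernoulli w') (openConn s a) (openConn s b) (openConn s c) ∧
        (∀ f : Sym2 (Fin n), s ∉ f → w' f ≠ 0 → w' f = w f) ∧
        ((fracEdges w').filter fun z => ¬ z.IsDiag ∧ s ∉ z).card < ((fracEdges w).filter fun z => ¬ z.IsDiag ∧ s ∉ z).card := by
  set H' := (SimpleGraph.fromEdgeSet {z : Sym2 (Fin n) | s ∉ z ∧ w z ≠ 0}).deleteEdges {s(t, t')}
  set B : Finset (Fin n) := Finset.univ.filter fun x => H'.Reachable t x with hB
  have hmemB : ∀ x, x ∈ B ↔ H'.Reachable t x := fun x => by simp [hB]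
  have hsB : s ∉ B := fun h => apexForest_root_not_mem w hts _ ((hmemB s).1 h)
  have ht'B : t' ∉ B := fun h => hbridge ((hmemB t').1 h)
  have htB : t ∈ B := (hmemB t).2 (SimpleGraph.Reachable.refl t)
  have hst' : s ≠ t' := ht's.symm
  have hwB : ∀ x ∈ B, ∀ y, y ∉ B → y ≠ s → y ≠ t' → w s(x, y) = 0 := by
    intro x hx y hy hys hyt'
    refine apexForest_cross w hts {s(t, t')} ((hmemB x).1 hx) (fun h => hy ((hmemB y).2 h)) hys fun hD => ?_
    rw [Set.mem_singleton_iff, Sym2.eq_iff] at hD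
    rcases hD with ⟨-, h⟩ | ⟨h, -⟩
    · exact hyt' h
    · exact ht'B (h ▸ hx)
  obtain ⟨w', h1, h2, h3, -⟩ := SahiBlobReduction.exists_blobReduce w B hsB ht'B hst' hwB
  have hagree : ∀ f : Sym2 (Fin n), s ∉ f → w' f ≠ 0 → w' f = w f := by
    intro f hsf hw'
    refine h2 f (fun x' hx' hmem => hw' ?_) fun h => hsf (h ▸ Sym2.mem_mk_left s t')
    obtain ⟨y', rfl⟩ := SahiBlobReduction.exists_eq_mk_of_mem hmem
    exact h1 x' hx' y'
  refine ⟨w', SahiBlobReduction.sahiE3_incStar_blobReduce w w' B hsB ht'B hst' hsB hwB h1 h2 h3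
      (fun h => ha ((hmemB a).1 h)) (fun h => hb ((hmemB b).1 h)) (fun h => hc ((hmemB c).1 h)), hagree, ?_⟩
  apply Finset.card_lt_card
  refine ⟨fun f hf => ?_, fun hsub => ?_⟩
  · rw [Finset.mem_filter] at hf ⊢
    obtain ⟨hff, hfd, hfs⟩ := hf
    refine ⟨?_, hfd, hfs⟩
    simp only [fracEdges, Finset.mem_filter, Finset.mem_univ, true_and] at hff ⊢
    have hne : w' f ≠ 0 := fun h => by rw [h] at hff; simp at hff
    rwa [hagree f hfs hne] at hff
  · have h := Finset.mem_filter.1 (hsub hfrac)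
    have h0 := h1 t htB t'
    simp only [fracEdges, Finset.mem_filter, Finset.mem_univ, true_and] at h
    rw [h0] at h
    simp at h

/-- **THEOREM C♯ (the increasing star when every environment cycle is sure).**  If every environment pair (`s ∉ z`, `w z ≠ 0`) of weight
`< 1` is a bridge of the environment `fromEdgeSet {z | s ∉ z ∧ w z ≠ 0}` — equivalently, every cycle of the positive graph avoiding the
root consists of weight-`1` pairs — then `E₃({s↔a},{s↔b},{s↔c}) ≥ 0` under `prodBernoulli w`, for all targets.  (Apex-forests are the case
with no environment cycle at all.) [this work] -/
theorem incStar_nonneg_of_sureEnvCycles (w : Sym2 (Fin n) → unitInterval) (s a b c : Fin n)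
    (hbr : ∀ u v : Fin n, (SimpleGraph.fromEdgeSet {z : Sym2 (Fin n) | s ∉ z ∧ w z ≠ 0}).Adj u v → w s(u, v) ≠ 1 →
      (SimpleGraph.fromEdgeSet {z : Sym2 (Fin n) | s ∉ z ∧ w z ≠ 0}).IsBridge s(u, v)) :
    0 ≤ sahiE3 (prodBernoulli w) (openConn s a) (openConn s b) (openConn s c) := by
  -- targets at the root are Harris-trivial
  by_cases has : a = s
  · subst has; exact incStar_nonneg_of_target_eq_root w a b c
  by_cases hbs : b = s
  · subst hbs; rw [sahiE3_comm₁₂]; exact incStar_nonneg_of_target_eq_root w b a c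
  by_cases hcs : c = s
  · subst hcs; rw [sahiE3_comm₂₃, sahiE3_comm₁₂]; exact incStar_nonneg_of_target_eq_root w c a b
  suffices H : ∀ (N : ℕ) (w : Sym2 (Fin n) → unitInterval),
      (∀ u v : Fin n, (SimpleGraph.fromEdgeSet {z : Sym2 (Fin n) | s ∉ z ∧ w z ≠ 0}).Adj u v → w s(u, v) ≠ 1 →
        (SimpleGraph.fromEdgeSet {z : Sym2 (Fin n) | s ∉ z ∧ w z ≠ 0}).IsBridge s(u, v)) →
      ((fracEdges w).filter fun z => ¬ z.IsDiag ∧ s ∉ z).card ≤ N →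
      0 ≤ sahiE3 (prodBernoulli w) (openConn s a) (openConn s b) (openConn s c) from
    H _ w hbr le_rfl
  intro N
  induction N with
  | zero =>
    intro w _ hN
    refine incStar_nonneg_of_nonRootDet w s a b c fun z hzd hsz => eq_zero_or_one_of_not_mem_fracEdges fun hz => ?_
    have hmem : z ∈ (fracEdges w).filter (fun z => ¬ z.IsDiag ∧ s ∉ z) := Finset.mem_filter.2 ⟨hz, hzd, hsz⟩
    have := Finset.card_pos.2 ⟨z, hmem⟩
    omega
  | succ N ih =>
    intro w hbr hN
    by_cases hempty : ((fracEdges w).filter fun z => ¬ z.IsDiag ∧ s ∉ z) = ∅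
    · exact ih w hbr (by rw [hempty, Finset.card_empty]; exact Nat.zero_le _)
    obtain ⟨z, hz⟩ := Finset.nonempty_iff_ne_empty.2 hempty
    -- class preservation under a sub-environment on which the weights `< 1` are unchanged
    have hclass : ∀ w' : Sym2 (Fin n) → unitInterval,
        SimpleGraph.fromEdgeSet {z : Sym2 (Fin n) | s ∉ z ∧ w' z ≠ 0} ≤ SimpleGraph.fromEdgeSet {z : Sym2 (Fin n) | s ∉ z ∧ w z ≠ 0} →
        (∀ u v : Fin n, (SimpleGraph.fromEdgeSet {z : Sym2 (Fin n) | s ∉ z ∧ w' z ≠ 0}).Adj u v → w' s(u, v) ≠ 1 → w s(u, v) ≠ 1) →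
        ∀ u v : Fin n, (SimpleGraph.fromEdgeSet {z : Sym2 (Fin n) | s ∉ z ∧ w' z ≠ 0}).Adj u v → w' s(u, v) ≠ 1 →
          (SimpleGraph.fromEdgeSet {z : Sym2 (Fin n) | s ∉ z ∧ w' z ≠ 0}).IsBridge s(u, v) :=
      fun w' hle hlt u v hadj h1 => isBridge_anti hle (hbr u v (hle hadj) (hlt u v hadj h1))
    have IH : ∀ (w' : Sym2 (Fin n) → unitInterval),
        SimpleGraph.fromEdgeSet {z : Sym2 (Fin n) | s ∉ z ∧ w' z ≠ 0} ≤ SimpleGraph.fromEdgeSet {z : Sym2 (Fin n) | s ∉ z ∧ w z ≠ 0} →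
        (∀ u v : Fin n, (SimpleGraph.fromEdgeSet {z : Sym2 (Fin n) | s ∉ z ∧ w' z ≠ 0}).Adj u v → w' s(u, v) ≠ 1 → w s(u, v) ≠ 1) →
        ((fracEdges w').filter fun z => ¬ z.IsDiag ∧ s ∉ z).card < ((fracEdges w).filter fun z => ¬ z.IsDiag ∧ s ∉ z).card →
        0 ≤ sahiE3 (prodBernoulli w') (openConn s a) (openConn s b) (openConn s c) :=
      fun w' hle hlt hcard => ih w' (hclass w' hle hlt) (by omega)
    -- the chosen fractional environment pair `z = s(u,v)`
    obtain ⟨⟨u, v⟩, rfl⟩ := Quot.exists_rep z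
    obtain ⟨hzf, hzd, hzs⟩ := Finset.mem_filter.1 hz
    have huv : u ≠ v := fun h => hzd (Sym2.mk_isDiag_iff.2 h)
    have hus : u ≠ s := fun h => hzs (h ▸ Sym2.mem_mk_left u v)
    have hvs : v ≠ s := fun h => hzs (h ▸ Sym2.mem_mk_right u v)
    have hzf' := hzf
    simp only [fracEdges, Finset.mem_filter, Finset.mem_univ, true_and] at hzf'
    have hw0 : w s(u, v) ≠ 0 := fun h => by rw [h] at hzf'; simp at hzf'
    have hw1 : w s(u, v) ≠ 1 := fun h => by rw [h] at hzf'; simp at hzf'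
    set H := SimpleGraph.fromEdgeSet {z : Sym2 (Fin n) | s ∉ z ∧ w z ≠ 0} with hH
    have hadj : H.Adj u v := by
      rw [hH, SimpleGraph.fromEdgeSet_adj]; exact ⟨⟨hzs, hw0⟩, huv⟩
    have hbridge : ¬ (H.deleteEdges {s(u, v)}).Reachable u v := SimpleGraph.isBridge_iff.1 (hbr u v hadj hw1)
    have hz' : s(v, u) ∈ (fracEdges w).filter (fun z => ¬ z.IsDiag ∧ s ∉ z) := by rw [Sym2.eq_swap]; exact hz
    have hbridge' : ¬ (H.deleteEdges {s(v, u)}).Reachable v u := by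
      rw [Sym2.eq_swap]; exact fun h => hbridge h.symm
    -- the pinned weights stay in the class
    have hupd : ∀ val : unitInterval, ∀ u' v' : Fin n,
        (SimpleGraph.fromEdgeSet {z : Sym2 (Fin n) | s ∉ z ∧ Function.update w s(u, v) val z ≠ 0}).Adj u' v' →
        Function.update w s(u, v) val s(u', v') ≠ 1 → w s(u', v') ≠ 1 := by
      intro val u' v' hadj' h1
      by_cases he : s(u', v') = s(u, v)
      · rw [he]; exact hw1
      · rwa [Function.update_of_ne he] at h1
    have h0 : 0 ≤ sahiE3 (prodBernoulli (Function.update w s(u, v) 0)) (openConn s a) (openConn s b) (openConn s c) :=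
      IH _ (envGraph_update_le w s _ 0 (Or.inr rfl)) (hupd 0) (fracNR_card_update_lt w s hz 0 (Or.inl rfl))
    have h1 : 0 ≤ sahiE3 (prodBernoulli (Function.update w s(u, v) 1)) (openConn s a) (openConn s b) (openConn s c) :=
      IH _ (envGraph_update_le w s _ 1 (Or.inl hw0)) (hupd 1) (fracNR_card_update_lt w s hz 1 (Or.inr rfl))
    have h0' : 0 ≤ sahiE3 (prodBernoulli (Function.update w s(v, u) 0)) (openConn s a) (openConn s b) (openConn s c) := by
      rw [Sym2.eq_swap]; exact h0
    have h1' : 0 ≤ sahiE3 (prodBernoulli (Function.update w s(v, u) 1)) (openConn s a) (openConn s b) (openConn s c) := by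
      rw [Sym2.eq_swap]; exact h1
    -- blob-reduced weights stay in the class
    have hblobclass : ∀ w' : Sym2 (Fin n) → unitInterval, (∀ f : Sym2 (Fin n), s ∉ f → w' f ≠ 0 → w' f = w f) →
        SimpleGraph.fromEdgeSet {z : Sym2 (Fin n) | s ∉ z ∧ w' z ≠ 0} ≤ H ∧
        (∀ u' v' : Fin n, (SimpleGraph.fromEdgeSet {z : Sym2 (Fin n) | s ∉ z ∧ w' z ≠ 0}).Adj u' v' →
          w' s(u', v') ≠ 1 → w s(u', v') ≠ 1) := by
      intro w' hag
      refine ⟨fun x y hxy => ?_, fun u' v' hadj' h1 => ?_⟩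
      · rw [SimpleGraph.fromEdgeSet_adj] at hxy
        rw [hH, SimpleGraph.fromEdgeSet_adj]
        exact ⟨⟨hxy.1.1, by rw [← hag _ hxy.1.1 hxy.1.2]; exact hxy.1.2⟩, hxy.2⟩
      · rw [SimpleGraph.fromEdgeSet_adj] at hadj'
        rwa [hag _ hadj'.1.1 hadj'.1.2] at h1
    -- Theorem B as the hypothesis of the chord move
    have hB : ∀ (w : Sym2 (Fin n) → unitInterval) (L : Set (Fin n)) (s u v a b c : Fin n),
        s ∉ L → u ∈ L → v ∉ L → a ∈ L → b ∉ L → c ∉ L →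
        (∀ x y : Fin n, x ∈ L → y ∉ L → y ≠ s → s(x, y) ≠ s(u, v) → w s(x, y) = 0) →
        (1 - (w s(u, v) : ℝ)) *
            sahiE3 (prodBernoulli (Function.update w s(u, v) 0)) (openConn s a) (openConn s b) (openConn s c)
          + (w s(u, v) : ℝ) *
            sahiE3 (prodBernoulli (Function.update w s(u, v) 1)) (openConn s a) (openConn s b) (openConn s c)
        ≤ sahiE3 (prodBernoulli w) (openConn s a) (openConn s b) (openConn s c) :=
      fun w L _ _ _ _ _ _ hsL huL hvL haL hbL hcL hcross => incStar_bridge_chord w L hsL huL hvL haL hbL hcL hcross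
    -- the component of `u`, and its mirror
    set L : Set (Fin n) := {x | (H.deleteEdges {s(u, v)}).Reachable u x}
    have hsL : s ∉ L := apexForest_root_not_mem w hus _
    have huL : u ∈ L := SimpleGraph.Reachable.refl u
    have hvL : v ∉ L := hbridge
    have hcross : ∀ x y : Fin n, x ∈ L → y ∉ L → y ≠ s → s(x, y) ≠ s(u, v) → w s(x, y) = 0 :=
      fun x y hx hy hys hne => apexForest_cross w hus {s(u, v)} hx hy hys (by rwa [Set.mem_singleton_iff])
    set M : Set (Fin n) := {x | x ∉ L ∧ x ≠ s}
    have hsM : s ∉ M := fun h => h.2 rfl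
    have hvM : v ∈ M := ⟨hvL, hvs⟩
    have huM : u ∉ M := fun h => h.1 huL
    have hcrossM : ∀ x y : Fin n, x ∈ M → y ∉ M → y ≠ s → s(x, y) ≠ s(v, u) → w s(x, y) = 0 := by
      intro x y hx hy hys hne
      have hyL : y ∈ L := by
        by_contra h
        exact hy ⟨h, hys⟩
      rw [Sym2.eq_swap]
      exact hcross y x hyL hx.1 hx.2 fun h => hne (Sym2.eq_swap.trans (h.trans Sym2.eq_swap))
    have haM : a ∉ L → a ∈ M := fun h => ⟨h, has⟩
    have hbM : b ∉ L → b ∈ M := fun h => ⟨h, hbs⟩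
    have hcM : c ∉ L → c ∈ M := fun h => ⟨h, hcs⟩
    have nM : ∀ {x : Fin n}, x ∈ L → x ∉ M := fun hx h => h.1 hx
    -- eight cases
    by_cases haL : a ∈ L <;> by_cases hbL : b ∈ L <;> by_cases hcL : c ∈ L
    · have hfar : ∀ {x : Fin n}, x ∈ L → ¬ (H.deleteEdges {s(v, u)}).Reachable v x := by
        intro x hx h
        rw [Sym2.eq_swap] at h
        exact hbridge (SimpleGraph.Reachable.trans hx h.symm)
      obtain ⟨w', hE, hag, hlt⟩ := apexForest_blob_eq w hvs hus hz' hbridge' (hfar haL) (hfar hbL) (hfar hcL)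
      obtain ⟨hle, hlt1⟩ := hblobclass w' hag
      rw [hE]; exact IH w' hle hlt1 hlt
    · exact apexForest_chord w M hB hsM hvM huM hcrossM (Or.inr (Or.inr ⟨hcM hcL, nM haL, nM hbL⟩)) h0' h1'
    · exact apexForest_chord w M hB hsM hvM huM hcrossM (Or.inr (Or.inl ⟨hbM hbL, nM haL, nM hcL⟩)) h0' h1'
    · exact apexForest_chord w L hB hsL huL hvL hcross (Or.inl ⟨haL, hbL, hcL⟩) h0 h1
    · exact apexForest_chord w M hB hsM hvM huM hcrossM (Or.inl ⟨haM haL, nM hbL, nM hcL⟩) h0' h1'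
    · exact apexForest_chord w L hB hsL huL hvL hcross (Or.inr (Or.inl ⟨hbL, haL, hcL⟩)) h0 h1
    · exact apexForest_chord w L hB hsL huL hvL hcross (Or.inr (Or.inr ⟨hcL, haL, hbL⟩)) h0 h1
    · obtain ⟨w', hE, hag, hlt⟩ := apexForest_blob_eq w hus hvs hz hbridge haL hbL hcL
      obtain ⟨hle, hlt1⟩ := hblobclass w' hag
      rw [hE]; exact IH w' hle hlt1 hlt

end IncStar

end Summit.CriticalPhenomena.PercolationContinuityZ3.Theorems
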